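import Literature.NumberTheory.DiophantineGeometry.ConductorExponentLeFiveProofs
import Literature.NumberTheory.DiophantineGeometry.TateAlgorithmIstarSuccNormalFormProofs
import Literature.NumberTheory.DiophantineGeometry.TateAlgorithmOrdDiscriminant
import Literature.NumberTheory.DiophantineGeometry.MinimalDiscriminantNormProofs
import Literature.NumberTheory.DiophantineGeometry.LocalReductionProofs
import HarnessLib

/-!
# Tate's algorithm with `2` a unit: `ord Δ = m + 1` for the types `III`, `III*`, `I₀*`, `Iₙ*`
# (the four tame additive types of Ogg's formula at `p = 3`)

Companion proof file (theorems only; no definitions, no named facts, no instances) of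
`Literature.NumberTheory.DiophantineGeometry.TateAlgorithm` and `…Conductor`, landed by the
tenured seat of bsd.S15 (`Literature.NumberTheory.EllipticCurves.conductorNorm_eq_artinConductorNat`)
as a bottom-up step in the printed proof of **Ogg's formula at the additive places of residue
characteristic `3`** (Silverman, *ATAEC*, Thm. IV.11.1, case `p = 3`, PDF pp. 366–371), whose
Galois form is the tree's named fact
`WeierstrassCurve.swanConductorAt_rationalTate_eq_wildConductorExponent_of_ringChar_eq_three`.

The tree *defines* the conductor exponent by Ogg's formula, `f_v = ord_v(Δ_min) + 1 - m_v`
(`WeierstrassCurve.conductorExponent`), and its wild part by `δ_v = f_v - ε_v`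
(`WeierstrassCurve.wildConductorExponent`).  So the discriminant side of Ogg's formula for a
given Kodaira type `T` is the row `v(Δ)` of Table 4.1 for that type.  Here we establish it for
the four additive types at which the book's proof finds `δ = 0` — `III` and `III*` ("`L/K` is at
worst tamely ramified … `v_K(𝒟_{E/K}) - f(E/K) - m(E/K) + 1 = 3 - (2+0) - 2 + 1 = 0`", and
"`= 9 - (2+0) - 8 + 1 = 0`", PDF p. 367), `I₀*` and `Iₙ*` (columns `I₀*`, `Iₙ*` of the table on
p. 368: over the ramified quadratic extension `M` the type becomes `I₀`, resp. `I₂ₙ`, and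
`2v_K(𝒟_{E/K}) - v_M(𝒟_{E/M}) = 12`, i.e. `v_K(Δ) = 6`, resp. `n + 6`) — over **any discrete
valuation ring with perfect residue field in which `2` is a unit** (no hypothesis on `3`):

* `TateAlgorithm.addVal_Δ_toNat_eq_three_of_kodairaSymbolOfMinimal_eq_III` — output `III` ⇒
  `ord Δ = 3`;
* `TateAlgorithm.addVal_Δ_toNat_eq_nine_of_kodairaSymbolOfMinimal_eq_IIIstar` — output `III*` ⇒
  `ord Δ = 9`;
* `TateAlgorithm.addVal_Δ_toNat_eq_six_of_kodairaSymbolOfMinimal_eq_Istar_zero` — output `I₀*` ⇒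
  `ord Δ = 6`;
* `TateAlgorithm.addVal_Δ_toNat_eq_of_kodairaSymbolOfMinimal_eq_Istar_succ` — output `Iₙ*`,
  `n ≥ 1` ⇒ `ord Δ = n + 6` **and `ord c₄ = 2`** (so `ord(j) = -n < 0`: these are exactly the
  potentially multiplicative additive types; "if `p ≠ 2` then `n = v(Δ) - 6`", IV.9.4 Step 7);
* `TateAlgorithm.addVal_Δ_toNat_eq_numComponents_add_one_of_isUnit_two` — the four together:
  `ord Δ = m(T) + 1`.

The branch lemmas are the tree's `addVal_Δ_toNat_eq_three_of_step4`,
`addVal_Δ_toNat_eq_nine_of_step9`, `step67_of_isUnit_two` (`ConductorExponentLeFiveProofs`, all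
three using only `2 ∈ Rˣ`) and `istarIndex_add_six` (`TateAlgorithmLocal`, `2 ∈ Rˣ`); this file
supplies the bookkeeping that the literal implementation `kodairaSymbolOfMinimal` reaches them on
the normalised models (`exists_variableChange_step{2,6,7,8,9}_of_perfectField`), as in
`addVal_Δ_toNat_le_numComponents_add_four` (which assumes `3` is a uniformiser).

At a finite place `v ∤ 2` of the fraction field of a Dedekind domain (perfect residue field of
`O_v`, the standing hypothesis of Tate's algorithm; automatic over number fields) this gives, for
an elliptic curve whose Kodaira symbol at `v` is `III`, `III*` or `Iₙ*` (`n ≥ 0`):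

* `WeierstrassCurve.ordMinimalDiscriminant_eq_numComponentsAt_add_one_of_kodairaSymbolAt` —
  `ord_v(Δ_min) = m_v + 1`;
* `WeierstrassCurve.conductorExponent_eq_two_of_kodairaSymbolAt`,
  `WeierstrassCurve.wildConductorExponent_eq_zero_of_kodairaSymbolAt` — **`f_v = 2`, `δ_v = 0`**:
  the discriminant side of Ogg's formula vanishes at these places, in every odd residue
  characteristic (new content only for `p = 3`; for `p ≥ 5` this is
  `ordMinimalDiscriminant_eq_numComponentsAt_add_one_holds`);
* `WeierstrassCurve.one_lt_valuation_j_of_kodairaSymbolAt_eq_Istar_succ` — type `Iₙ*`, `n ≥ 1`,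
  at `v ∤ 2` forces `ord_v(j) < 0` (`1 < v.valuation K W.j`), the hypothesis under which the
  Galois side `Sw_𝔓(V_ℓ E) = 0` is the theorem
  `swanConductorAt_rationalTate_eq_zero_of_one_lt_valuation_j` (`QuadraticTwistTateFormProofs`).

## References

* [SilvermanATAEC1994] J. H. Silverman, *Advanced Topics in the Arithmetic of Elliptic Curves*,
  GTM 151, Springer 1994: IV.9.4 (Tate's algorithm, Steps 4, 6, 7, 9; PDF pp. 343–346) and
  Table 4.1 (p. 365); Thm. IV.11.1 and its proof for `p = 3` (PDF pp. 366–371: types `III`,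
  `III*` p. 367, table p. 368).
* [OggAJM1967] A. P. Ogg, *Elliptic curves and wild ramification*, Amer. J. Math. 89 (1967).

## Design

Pure theorems; DVR part in `namespace Literature.NumberTheory.DiophantineGeometry.TateAlgorithm`
(next to `istarIndex_add_six`, `step67_of_isUnit_two`), place part in `namespace WeierstrassCurve`
(dot-notation extensions next to `conductorExponent`, `wildConductorExponent`).  The
`if`-cascade of `kodairaSymbolOfMinimal` is unfolded by local `have`s (the corresponding
top-level lemmas exist in `NeronComponentIndexType{III,IIIstar}Proofs`, not imported here to keep
the topic layering).  Axioms: `propext`, `Classical.choice`, `Quot.sound`.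
-/

open Polynomial IsLocalRing IsDedekindDomain
open IsDiscreteValuationRing hiding maximalIdeal

namespace Literature.NumberTheory.DiophantineGeometry

namespace TateAlgorithm

variable {R : Type*} [CommRing R] [IsDomain R] [IsDiscreteValuationRing R]

/-! ## `ord Δ` at the outputs `III`, `III*`, `I₀*`, `Iₙ*` when `2 ∈ Rˣ` -/

/-- **Type `III` has `ord Δ = 3` when `2 ∈ Rˣ`** (perfect residue field).  If Tate's algorithm
returns `III` then, on the Step-2 model `W₂` (`π ∣ a₃, a₄, a₆`), `π ∣ b₂`, `π² ∣ a₆` and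
`π³ ∤ b₈`, and `addVal_Δ_toNat_eq_three_of_step4` gives `ord Δ(W₂) = ord Δ = 3`
(Silverman *ATAEC* IV.9.4 Step 4; the row `v(Δ) = 3` of Table 4.1 thus holds for type `III` in
every odd residue characteristic — at `p = 3` this is "`v_K(Δ) = 3`" in the proof of IV.11.1,
PDF p. 367). [cite: SilvermanATAEC1994, IV.9.4 Step 4 and proof of IV.11.1, p = 3, type III (PDF p. 367)] -/
theorem addVal_Δ_toNat_eq_three_of_kodairaSymbolOfMinimal_eq_III [PerfectField (ResidueField R)]
    (h2 : IsUnit (2 : R)) (V : WeierstrassCurve R) (hV : V.kodairaSymbolOfMinimal = .III) :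
    (addVal R V.Δ).toNat = 3 := by
  classical
  have hϖ : Irreducible (uniformizer R) := irreducible_uniformizer
  -- the `if`-cascade of `kodairaSymbolOfMinimal` returns `III` iff Steps 1–3 fail, Step 4 fires
  have tree : ∀ (p1 p2 p3 p4 p5 p6 p7 p8 p9 p10 : Prop) [Decidable p1] [Decidable p2]
      [Decidable p3] [Decidable p4] [Decidable p5] [Decidable p6] [Decidable p7] [Decidable p8]
      [Decidable p9] [Decidable p10] (n m : ℕ),
      (if p1 then KodairaSymbol.I 0 else if p2 then .I n else if p3 then .II else if p4 then .III
        else if p5 then .IV else if p6 then .Istar 0 else if p7 then .Istar m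
        else if p8 then .IVstar else if p9 then .IIIstar else if p10 then .IIstar else .I 0) =
          .III ↔ ¬ p1 ∧ ¬ p2 ∧ ¬ p3 ∧ p4 := by
    intros; split_ifs <;> simp [*]
  unfold WeierstrassCurve.kodairaSymbolOfMinimal at hV
  obtain ⟨h1, h2', h3, h4⟩ := (tree _ _ _ _ _ _ _ _ _ _ _ _).mp hV
  rw [not_not] at h1 h2' h3
  have hex2 := exists_variableChange_step2_of_perfectField V h1
  have hN2 : normalizeStep2 V = hex2.choose • V := dif_pos hex2
  obtain ⟨hu2, hA₃, hA₄, -⟩ := hex2.choose_spec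
  rw [hN2] at h2' h3 h4
  set W₂ := hex2.choose • V with hW₂
  rw [← Δ_smul_of_u_eq_one hu2 V]
  exact addVal_Δ_toNat_eq_three_of_step4 hϖ h2 W₂
    ((mem_maximalIdeal_iff_dvd_of_irreducible hϖ _).mp hA₃)
    ((mem_maximalIdeal_iff_dvd_of_irreducible hϖ _).mp hA₄)
    ((mem_maximalIdeal_pow_iff_dvd_of_irreducible hϖ _ _).mp h3)
    ((mem_maximalIdeal_iff_dvd_of_irreducible hϖ _).mp h2')
    (mt (mem_maximalIdeal_pow_iff_dvd_of_irreducible hϖ _ _).mpr h4)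

/-- **Type `III*` has `ord Δ = 9` when `2 ∈ Rˣ`** (perfect residue field).  If Tate's algorithm
returns `III*` then Steps 1–8 failed, the Step-2, -6, -8 and -9 translations exist
(`exists_variableChange_step{2,6,8,9}_of_perfectField`), and on the Step-9 model (`π ∣ a₁`,
`π² ∣ a₂`, `π³ ∣ a₃, a₄`, `π⁵ ∣ a₆`) `π⁴ ∤ a₄`, so `addVal_Δ_toNat_eq_nine_of_step9` gives
`ord Δ = 9` (Silverman *ATAEC* IV.9.4 Step 9; at `p = 3`: "`v_K(Δ) = 9`", PDF p. 367).
[cite: SilvermanATAEC1994, IV.9.4 Step 9 and proof of IV.11.1, p = 3, type III* (PDF p. 367)] -/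
theorem addVal_Δ_toNat_eq_nine_of_kodairaSymbolOfMinimal_eq_IIIstar
    [PerfectField (ResidueField R)] (h2 : IsUnit (2 : R)) (V : WeierstrassCurve R)
    (hV : V.kodairaSymbolOfMinimal = .IIIstar) : (addVal R V.Δ).toNat = 9 := by
  classical
  have hϖ : Irreducible (uniformizer R) := irreducible_uniformizer
  -- the `if`-cascade returns `III*` iff Steps 1–8 fail and Step 9 fires
  have tree : ∀ (p1 p2 p3 p4 p5 p6 p7 p8 p9 p10 : Prop) [Decidable p1] [Decidable p2]
      [Decidable p3] [Decidable p4] [Decidable p5] [Decidable p6] [Decidable p7] [Decidable p8]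
      [Decidable p9] [Decidable p10] (n m : ℕ),
      (if p1 then KodairaSymbol.I 0 else if p2 then .I n else if p3 then .II else if p4 then .III
        else if p5 then .IV else if p6 then .Istar 0 else if p7 then .Istar m
        else if p8 then .IVstar else if p9 then .IIIstar else if p10 then .IIstar else .I 0) =
          .IIIstar ↔ ¬ p1 ∧ ¬ p2 ∧ ¬ p3 ∧ ¬ p4 ∧ ¬ p5 ∧ ¬ p6 ∧ ¬ p7 ∧ ¬ p8 ∧ p9 := by
    intros; split_ifs <;> simp [*]
  unfold WeierstrassCurve.kodairaSymbolOfMinimal at hV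
  obtain ⟨h1, h2', h3, h4, h5, h6, h7, h8, h9⟩ := (tree _ _ _ _ _ _ _ _ _ _ _ _).mp hV
  rw [not_not] at h1 h2' h3 h4 h5
  -- Step 2
  have hex2 := exists_variableChange_step2_of_perfectField V h1
  have hN2 : normalizeStep2 V = hex2.choose • V := dif_pos hex2
  obtain ⟨hu2, hA₃, hA₄, -⟩ := hex2.choose_spec
  rw [hN2] at h2' h3 h4 h5 h6 h7 h8 h9
  -- Step 6
  have hex6 := exists_variableChange_step6_of_perfectField h2' hA₃ hA₄ h3 h5 h4
  have hN6 : normalizeStep6 (hex2.choose • V) = hex6.choose • (hex2.choose • V) :=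
    dif_pos hex6
  obtain ⟨hu6, hB₁, hB₂, hB₃, hB₄, hB₆⟩ := hex6.choose_spec
  rw [hN6] at h6 h7 h8 h9
  -- Step 8
  have hex8 := exists_variableChange_step8_of_perfectField hB₁ hB₂ hB₃ hB₄ hB₆ h6 h7
  have hN8 : normalizeStep8 (hex6.choose • (hex2.choose • V)) =
      hex8.choose • (hex6.choose • (hex2.choose • V)) := dif_pos hex8
  obtain ⟨hu8, hD₁, hD₂, hD₃, hD₄, hD₆⟩ := hex8.choose_spec
  rw [hN8] at h8 h9
  -- Step 9
  have hex9 := exists_variableChange_step9_of_perfectField hD₁ hD₂ hD₃ hD₄ hD₆ h8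
  have hN9 : normalizeStep9 (hex8.choose • (hex6.choose • (hex2.choose • V))) =
      hex9.choose • (hex8.choose • (hex6.choose • (hex2.choose • V))) := dif_pos hex9
  obtain ⟨hu9, hE₁, hE₂, hE₃, hE₄, hE₆⟩ := hex9.choose_spec
  rw [hN9] at h9
  set W₉ := hex9.choose • (hex8.choose • (hex6.choose • (hex2.choose • V))) with hW₉
  have hΔ9 : W₉.Δ = V.Δ := by
    rw [hW₉, Δ_smul_of_u_eq_one hu9, Δ_smul_of_u_eq_one hu8, Δ_smul_of_u_eq_one hu6,
      Δ_smul_of_u_eq_one hu2]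
  rw [← hΔ9]
  exact addVal_Δ_toNat_eq_nine_of_step9 hϖ h2 W₉
    ((mem_maximalIdeal_iff_dvd_of_irreducible hϖ _).mp hE₁)
    ((mem_maximalIdeal_pow_iff_dvd_of_irreducible hϖ _ _).mp hE₂)
    ((mem_maximalIdeal_pow_iff_dvd_of_irreducible hϖ _ _).mp hE₃)
    ((mem_maximalIdeal_pow_iff_dvd_of_irreducible hϖ _ _).mp hE₄)
    ((mem_maximalIdeal_pow_iff_dvd_of_irreducible hϖ _ _).mp hE₆)
    (mt (mem_maximalIdeal_pow_iff_dvd_of_irreducible hϖ _ _).mpr h9)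

/-- **Type `I₀*` has `ord Δ = 6` when `2 ∈ Rˣ`** (perfect residue field, `Δ ≠ 0`).  The output
`I₀*` means that Step 6 fired (`kodairaSymbolOfMinimal_eq_Istar_zero_imp`: the junk `I₀*` of an
exhausted Step 7 does not occur), and on the Step-6 model three distinct roots of `P(T)` give
`ord Δ = 6` (`step67_of_isUnit_two`; Silverman *ATAEC* IV.9.4 Step 6, and the column `I₀*` of the
table in the proof of IV.11.1 for `p = 3`, PDF p. 368: `Type(E/M) = I₀`,
`2v_K(𝒟_{E/K}) - v_M(𝒟_{E/M}) = 12`).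
[cite: SilvermanATAEC1994, IV.9.4 Step 6 and proof of IV.11.1, p = 3, table p. 368] -/
theorem addVal_Δ_toNat_eq_six_of_kodairaSymbolOfMinimal_eq_Istar_zero
    [PerfectField (ResidueField R)] (h2 : IsUnit (2 : R)) (V : WeierstrassCurve R)
    (hΔ0 : V.Δ ≠ 0) (hV : V.kodairaSymbolOfMinimal = .Istar 0) : (addVal R V.Δ).toNat = 6 := by
  classical
  have hϖ : Irreducible (uniformizer R) := irreducible_uniformizer
  obtain ⟨h1, h2', h3, h4, h5, h6⟩ := kodairaSymbolOfMinimal_eq_Istar_zero_imp V hΔ0 hV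
  have hex2 := exists_variableChange_step2_of_perfectField V h1
  have hN2 : normalizeStep2 V = hex2.choose • V := dif_pos hex2
  obtain ⟨hu2, hA₃, hA₄, -⟩ := hex2.choose_spec
  rw [hN2] at h2' h3 h4 h5 h6
  have hex6 := exists_variableChange_step6_of_perfectField h2' hA₃ hA₄ h3 h5 h4
  have hN6 : normalizeStep6 (hex2.choose • V) = hex6.choose • (hex2.choose • V) :=
    dif_pos hex6
  obtain ⟨hu6, hB₁, hB₂, hB₃, hB₄, hB₆⟩ := hex6.choose_spec
  rw [hN6] at h6
  set W₆ := hex6.choose • (hex2.choose • V) with hW₆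
  have hΔ6 : W₆.Δ = V.Δ := by rw [hW₆, Δ_smul_of_u_eq_one hu6, Δ_smul_of_u_eq_one hu2]
  rw [← hΔ6]
  exact (step67_of_isUnit_two h2 W₆ ((mem_maximalIdeal_iff_dvd_of_irreducible hϖ _).mp hB₁)
    ((mem_maximalIdeal_iff_dvd_of_irreducible hϖ _).mp hB₂)
    ((mem_maximalIdeal_pow_iff_dvd_of_irreducible hϖ _ _).mp hB₃)
    ((mem_maximalIdeal_pow_iff_dvd_of_irreducible hϖ _ _).mp hB₄)
    ((mem_maximalIdeal_pow_iff_dvd_of_irreducible hϖ _ _).mp hB₆)).1 h6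

/-- **Type `Iₙ*`, `n ≥ 1`, has `ord Δ = n + 6` and `ord c₄ = 2` when `2 ∈ Rˣ`** (perfect residue
field, `Δ ≠ 0`).  If Tate's algorithm returns `Istar (n + 1)` then Step 7 fired on the Step-6
model `W₆` with the sub-procedure returning `n + 1`; a double root of `P(T)` gives `π⁷ ∣ Δ` and
`c₄ = π²u`, `u ∈ Rˣ` (`step67_of_isUnit_two`), the initial translation of Step 7 exists
(`exists_variableChange_step7_of_perfectField`), and `istarIndex_add_six` ("if `p ≠ 2` then
`n = v(Δ) - 6`", Silverman *ATAEC* IV.9.4 Step 7, PDF p. 346) gives `ord Δ = (n + 1) + 6`.  At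
`p = 3` this is the column `Iₙ*` of the table in the proof of IV.11.1 (PDF p. 368:
`Type(E/M) = I₂ₙ`, `2v_K(𝒟_{E/K}) - v_M(𝒟_{E/M}) = 12`, i.e. `v_K(Δ) = n + 6`).
[cite: SilvermanATAEC1994, IV.9.4 Step 7 and proof of IV.11.1, p = 3, table p. 368] -/
theorem addVal_Δ_toNat_eq_of_kodairaSymbolOfMinimal_eq_Istar_succ
    [PerfectField (ResidueField R)] (h2 : IsUnit (2 : R)) (V : WeierstrassCurve R)
    (hΔ0 : V.Δ ≠ 0) {n : ℕ} (hV : V.kodairaSymbolOfMinimal = .Istar (n + 1)) :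
    (addVal R V.Δ).toNat = n + 7 ∧ ∃ u, IsUnit u ∧ V.c₄ = uniformizer R ^ 2 * u := by
  classical
  have hϖ : Irreducible (uniformizer R) := irreducible_uniformizer
  unfold WeierstrassCurve.kodairaSymbolOfMinimal at hV
  obtain ⟨h1, h2', h3, h4, h5, h6, h7, hidx⟩ :=
    (tateTree_eq_Istar_succ_iff _ _ _ _ _ _ _ _ _ _ _ _ _).mp hV
  rw [not_not] at h1 h2' h3 h4 h5
  -- Steps 2 and 6
  have hex2 := exists_variableChange_step2_of_perfectField V h1
  have hN2 : normalizeStep2 V = hex2.choose • V := dif_pos hex2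
  obtain ⟨hu2, hA₃, hA₄, -⟩ := hex2.choose_spec
  rw [hN2] at h2' h3 h4 h5 h6 h7 hidx
  have hex6 := exists_variableChange_step6_of_perfectField h2' hA₃ hA₄ h3 h5 h4
  have hN6 : normalizeStep6 (hex2.choose • V) = hex6.choose • (hex2.choose • V) :=
    dif_pos hex6
  obtain ⟨hu6, hB₁, hB₂, hB₃, hB₄, hB₆⟩ := hex6.choose_spec
  rw [hN6] at h6 h7 hidx
  set W₆ := hex6.choose • (hex2.choose • V) with hW₆
  have hΔ6 : W₆.Δ = V.Δ := by rw [hW₆, Δ_smul_of_u_eq_one hu6, Δ_smul_of_u_eq_one hu2]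
  have hc₄6 : W₆.c₄ = V.c₄ := by rw [hW₆, c₄_smul_of_u_eq_one hu6, c₄_smul_of_u_eq_one hu2]
  have hΔ60 : W₆.Δ ≠ 0 := by rwa [hΔ6]
  have hT := step67_of_isUnit_two h2 W₆ ((mem_maximalIdeal_iff_dvd_of_irreducible hϖ _).mp hB₁)
    ((mem_maximalIdeal_iff_dvd_of_irreducible hϖ _).mp hB₂)
    ((mem_maximalIdeal_pow_iff_dvd_of_irreducible hϖ _ _).mp hB₃)
    ((mem_maximalIdeal_pow_iff_dvd_of_irreducible hϖ _ _).mp hB₄)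
    ((mem_maximalIdeal_pow_iff_dvd_of_irreducible hϖ _ _).mp hB₆)
  obtain ⟨hΔ7, hT7⟩ := hT.2 h6
  have hc₄ := hT7 h7
  have hex7 := exists_variableChange_step7_of_perfectField hB₁ hB₂ hB₃ hB₄ hB₆ h7
  have key := istarIndex_add_six h2 W₆ hΔ60 hΔ7 hc₄ hex7
  rw [hidx, hΔ6] at key
  refine ⟨by omega, ?_⟩
  rw [← hc₄6]
  exact hc₄

/-- **`ord Δ = m(T) + 1` for the tame additive types `T = III, III*, Iₙ*` (`n ≥ 0`) when
`2 ∈ Rˣ`** (perfect residue field, `Δ ≠ 0`): the rows `m` and `v(Δ)` of Silverman *ATAEC*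
Table 4.1 (`2, 8, n + 5` and `3, 9, n + 6`) hold for these outputs of Tate's algorithm in every
odd residue characteristic; equivalently, by Ogg's formula taken as the definition of `f`,
`f = 2` and `δ = 0` at the places of these types — for `p = 3` the four columns `III`, `III*`
(PDF p. 367), `I₀*`, `Iₙ*` (table p. 368) of the proof of Thm. IV.11.1.
[cite: SilvermanATAEC1994, Table 4.1 and proof of IV.11.1, p = 3 (PDF pp. 367–368)] -/
theorem addVal_Δ_toNat_eq_numComponents_add_one_of_isUnit_two [PerfectField (ResidueField R)]
    (h2 : IsUnit (2 : R)) (V : WeierstrassCurve R) (hΔ0 : V.Δ ≠ 0)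
    (hT : V.kodairaSymbolOfMinimal = .III ∨ V.kodairaSymbolOfMinimal = .IIIstar ∨
      ∃ n, V.kodairaSymbolOfMinimal = .Istar n) :
    (addVal R V.Δ).toNat = V.kodairaSymbolOfMinimal.numComponents + 1 := by
  rcases hT with h | h | ⟨n, h⟩
  · rw [addVal_Δ_toNat_eq_three_of_kodairaSymbolOfMinimal_eq_III h2 V h, h]; rfl
  · rw [addVal_Δ_toNat_eq_nine_of_kodairaSymbolOfMinimal_eq_IIIstar h2 V h, h]; rfl
  · cases n with
    | zero =>
      rw [addVal_Δ_toNat_eq_six_of_kodairaSymbolOfMinimal_eq_Istar_zero h2 V hΔ0 h, h]; rfl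
    | succ n =>
      rw [(addVal_Δ_toNat_eq_of_kodairaSymbolOfMinimal_eq_Istar_succ h2 V hΔ0 h).1, h,
        KodairaSymbol.numComponents_Istar]

end TateAlgorithm

end Literature.NumberTheory.DiophantineGeometry

/-! ## At a finite place `v ∤ 2`: `ord_v(Δ_min) = m_v + 1`, `f_v = 2`, `δ_v = 0` for the types
`III`, `III*`, `Iₙ*`, and `ord_v(j) < 0` for `Iₙ*`, `n ≥ 1` -/

namespace WeierstrassCurve

open Literature.NumberTheory.DiophantineGeometry Literature.NumberTheory.DiophantineGeometry.TateAlgorithm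

section Local

variable {A : Type*} [CommRing A] [IsDedekindDomain A] {K : Type*} [Field K]
  [Algebra A K] [IsFractionRing A K] (v : HeightOneSpectrum A) (W : WeierstrassCurve K)

/-- **`ord_v(Δ_min) = m_v + 1` at a place `v ∤ 2` of Kodaira type `III`, `III*` or `Iₙ*`**
(`n ≥ 0`; elliptic `W`, perfect residue field of `O_v`): Tate's algorithm on the integral local
minimal model over `O_v`, in which `2` is a unit (`isUnit_two_adicCompletionIntegers`), by
`addVal_Δ_toNat_eq_numComponents_add_one_of_isUnit_two`.  Silverman *ATAEC* Table 4.1 and the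
proof of IV.11.1 for `p = 3` (PDF pp. 367–368).
[cite: SilvermanATAEC1994, Table 4.1 and proof of IV.11.1, p = 3 (PDF pp. 367–368)] -/
theorem ordMinimalDiscriminant_eq_numComponentsAt_add_one_of_kodairaSymbolAt [W.IsElliptic]
    [PerfectField (IsLocalRing.ResidueField (v.adicCompletionIntegers K))]
    (h2 : ringChar (A ⧸ v.asIdeal) ≠ 2)
    (hT : W.kodairaSymbolAt v = .III ∨ W.kodairaSymbolAt v = .IIIstar ∨
      ∃ n, W.kodairaSymbolAt v = .Istar n) :
    W.ordMinimalDiscriminant v = W.numComponentsAt v + 1 := by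
  have hu2 := HeightOneSpectrum.isUnit_two_adicCompletionIntegers K v h2
  rw [kodairaSymbolAt_def] at hT
  unfold numComponentsAt
  rw [kodairaSymbolAt_def]
  exact addVal_Δ_toNat_eq_numComponents_add_one_of_isUnit_two hu2 _
    (localMinimalIntegralModel_Δ_ne_zero v W) hT

/-- **`f_v = 2` at a place `v ∤ 2` of Kodaira type `III`, `III*` or `Iₙ*`** (`n ≥ 0`): Ogg's
formula `f_v = ord_v(Δ_min) + 1 - m_v` (the definition of `conductorExponent`) with
`ord_v(Δ_min) = m_v + 1`.  For `p = 3` these are the four types at which Silverman's proof of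
*ATAEC* IV.11.1 finds `f(E/K) = ε + δ = 2 + 0` (PDF pp. 367–368).
[cite: SilvermanATAEC1994, proof of IV.11.1, p = 3 (PDF pp. 367–368)] -/
theorem conductorExponent_eq_two_of_kodairaSymbolAt [W.IsElliptic]
    [PerfectField (IsLocalRing.ResidueField (v.adicCompletionIntegers K))]
    (h2 : ringChar (A ⧸ v.asIdeal) ≠ 2)
    (hT : W.kodairaSymbolAt v = .III ∨ W.kodairaSymbolAt v = .IIIstar ∨
      ∃ n, W.kodairaSymbolAt v = .Istar n) :
    W.conductorExponent v = 2 := by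
  unfold conductorExponent
  rw [W.ordMinimalDiscriminant_eq_numComponentsAt_add_one_of_kodairaSymbolAt v h2 hT]
  omega

/-- **`δ_v = 0` at a place `v ∤ 2` of Kodaira type `III`, `III*` or `Iₙ*`** (`n ≥ 0`): the
wild part `δ_v = f_v - ε_v` (`wildConductorExponent`) vanishes since `f_v = 2 = ε_v` (additive
types).  This is the discriminant side of Ogg's formula at these places; for `p = 3` the book's
"`δ(E/K) = 0`" for types `III`, `III*` (PDF p. 367) and, via `δ(E/K) = δ(E/M)/2` with `E/M` of
type `I₀`, `I₂ₙ`, for `I₀*`, `Iₙ*` (p. 368).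
[cite: SilvermanATAEC1994, proof of IV.11.1, p = 3 (PDF pp. 367–368)] -/
theorem wildConductorExponent_eq_zero_of_kodairaSymbolAt [W.IsElliptic]
    [PerfectField (IsLocalRing.ResidueField (v.adicCompletionIntegers K))]
    (h2 : ringChar (A ⧸ v.asIdeal) ≠ 2)
    (hT : W.kodairaSymbolAt v = .III ∨ W.kodairaSymbolAt v = .IIIstar ∨
      ∃ n, W.kodairaSymbolAt v = .Istar n) :
    W.wildConductorExponent v = 0 := by
  unfold wildConductorExponent
  rw [W.conductorExponent_eq_two_of_kodairaSymbolAt v h2 hT]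
  rcases hT with h | h | ⟨n, h⟩ <;> rw [h] <;> rfl

/-- **Type `Iₙ*`, `n ≥ 1`, at a place `v ∤ 2` forces `ord_v(j) < 0`** (`1 < v.valuation K W.j`):
on the integral local minimal model `M` over `O_v`, `ord c₄(M) = 2` and `ord Δ(M) = n + 6`
(`addVal_Δ_toNat_eq_of_kodairaSymbolOfMinimal_eq_Istar_succ`), and `j · Δ(M) = c₄(M)³` with
`j = j(E)` a `K_v`-isomorphism invariant, so `ord_v(j) = 6 - (n + 6) = -n < 0` (Silverman
*ATAEC* IV.9.4 Step 7 and Table 4.1, Ex. 4.37: `Iₙ*` with `p ≠ 2` has `v(j) = -n`; these are the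
potentially multiplicative additive places).
[cite: SilvermanATAEC1994, IV.9.4 Step 7 and Table 4.1] -/
theorem one_lt_valuation_j_of_kodairaSymbolAt_eq_Istar_succ [W.IsElliptic]
    [PerfectField (IsLocalRing.ResidueField (v.adicCompletionIntegers K))]
    (h2 : ringChar (A ⧸ v.asIdeal) ≠ 2) {n : ℕ} (hT : W.kodairaSymbolAt v = .Istar (n + 1)) :
    1 < v.valuation K W.j := by
  have hu2 := HeightOneSpectrum.isUnit_two_adicCompletionIntegers K v h2
  rw [kodairaSymbolAt_def] at hT
  set O := v.adicCompletionIntegers K with hO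
  set M := W.localMinimalIntegralModel v with hM
  have hΔ0 : M.Δ ≠ 0 := localMinimalIntegralModel_Δ_ne_zero v W
  obtain ⟨hord, u, hu, hc₄⟩ :=
    addVal_Δ_toNat_eq_of_kodairaSymbolOfMinimal_eq_Istar_succ hu2 M hΔ0 hT
  -- valuations on `K_v` of `Δ(M)` and `c₄(M)`
  obtain ⟨N, hN, hvΔ⟩ := HeightOneSpectrum.exists_addVal_adicCompletionIntegers_eq K v M.Δ hΔ0
  have hNn : N = n + 7 := by
    have := congrArg ENat.toNat hN
    rw [hord] at this
    simpa using this.symm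
  rw [hNn] at hvΔ
  have hϖ : Irreducible (uniformizer O) := irreducible_uniformizer
  obtain ⟨Nπ, hNπ, hvπ⟩ :=
    HeightOneSpectrum.exists_addVal_adicCompletionIntegers_eq K v (uniformizer O) hϖ.ne_zero
  have hNπ1 : Nπ = 1 := by
    have h1 : addVal O (uniformizer O) = 1 := addVal_uniformizer hϖ
    rw [h1] at hNπ
    exact_mod_cast hNπ.symm
  rw [hNπ1] at hvπ
  have hvu : Valued.v ((u : O) : v.adicCompletion K) = 1 :=
    HeightOneSpectrum.adicCompletionIntegers.isUnit_iff_valued_eq_one.mp hu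
  have hvc₄ : Valued.v ((M.c₄ : O) : v.adicCompletion K) = WithZero.exp (-2 : ℤ) := by
    rw [hc₄]
    push_cast
    rw [map_mul, map_pow, hvπ, hvu, mul_one, ← WithZero.exp_nsmul]
    norm_num
  -- `j · Δ(M) = c₄(M)³` in `K_v`
  have hjΔ : ∀ (E : WeierstrassCurve (v.adicCompletion K)) [E.IsElliptic],
      E.j * E.Δ = E.c₄ ^ 3 := fun E _ ↦ by
    rw [WeierstrassCurve.j, ← coe_Δ', mul_comm, ← mul_assoc, Units.mul_inv, one_mul]
  haveI hXell : (W.baseChange (v.adicCompletion K)).IsElliptic := by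
    unfold baseChange; infer_instance
  obtain ⟨C, hC⟩ : ∃ C : VariableChange (v.adicCompletion K),
      C • W.baseChange (v.adicCompletion K) = W.localMinimalModel v := ⟨_, rfl⟩
  have key : (W.j : v.adicCompletion K) * ((M.Δ : O) : v.adicCompletion K) =
      ((M.c₄ : O) : v.adicCompletion K) ^ 3 := by
    have hj' : (C • W.baseChange (v.adicCompletion K)).j = (W.j : v.adicCompletion K) := by
      rw [variableChange_j]; exact W.map_j _
    have hΔ' : ((M.Δ : O) : v.adicCompletion K) = (C • W.baseChange (v.adicCompletion K)).Δ := by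
      rw [hC, hM, localMinimalIntegralModel]
      exact integralModel_Δ_eq (v.adicCompletionIntegers K) (W.localMinimalModel v)
    have hc₄' : ((M.c₄ : O) : v.adicCompletion K) =
        (C • W.baseChange (v.adicCompletion K)).c₄ := by
      rw [hC, hM, localMinimalIntegralModel]
      exact integralModel_c₄_eq (v.adicCompletionIntegers K) (W.localMinimalModel v)
    rw [hΔ', hc₄', ← hj']
    exact hjΔ _
  -- read off `v(j) = exp (n + 1) > 1`
  have hvj : Valued.v (W.j : v.adicCompletion K) = WithZero.exp ((n : ℤ) + 1) := by
    have h := congrArg Valued.v key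
    rw [map_mul, map_pow, hvΔ, hvc₄, ← WithZero.exp_nsmul] at h
    have hne : WithZero.exp (-((n + 7 : ℕ) : ℤ)) ≠ 0 := WithZero.exp_ne_zero
    rw [← eq_div_iff hne] at h
    rw [h, ← WithZero.exp_sub]
    congr 1
    push_cast
    ring
  rw [← HeightOneSpectrum.valuedAdicCompletion_eq_valuation', hvj, ← WithZero.exp_zero,
    WithZero.exp_lt_exp]
  omega

end Local

end WeierstrassCurve
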